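import Mathlib
import HarnessLib

/-!
# SoloInformed — Kubert 2-torsion witnesses: three Γ-monomial identities that are NOT consequences of
the functional equations, while their squares are (levels 15, 33, 35; kernel certificates)

For a level `N` let `L_N ⊆ ℤ^{ℤ/N}` be the lattice spanned by the REFLECTION vectors `e_a + e_{-a}`
(`Γ(x)Γ(1-x) = π / sin πx`) and the DISTRIBUTION vectors `1_{x ≡ y (M)} - e_{(N/M) y}`, `M ∣ N`
(Gauss multiplication), in exactly the shapes of `Literature.…hodge_eq_combination_den_two`
(Koblitz–Ogus with denominator `2`: for every Hodge-type exponent vector `f`, `2f ∈ L_N`).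
We certify, for three explicit Hodge-type exponent vectors `f`, that `f ∉ L_N` although `2f ∈ L_N`:
`f` represents a non-zero class of the 2-torsion group `Sat(L_N)/L_N` (Kubert's `H²(±, U)`,
Das 2000), i.e. the algebraic Γ-monomial `Γ(f)` is a SQUARE ROOT of a standard relation but not a
standard relation:

* `N = 15` (Das, TAMS 352 (2000), p. 3558): `f = [1/3] + [2/15] - [4/15] - [1/5]`,
  `Γ(1/3)Γ(2/15)/(Γ(4/15)Γ(1/5)) = 3^{1/5} 5^{-1/12} (sin(4π/15) sin(π/5)/(sin(π/3) sin(2π/15)))^{1/2}`;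
* `N = 33` (the Hodge `(2,2)`-character `(7,10,13,19,22,28)` of the Fermat fourfold `X⁴₃₃` found by
  da Silva, arXiv:2101.04739 Prop. 3.6, proved algebraic by Jumagulov, arXiv:2608.18134 Thm. 1.4):
  `f = [7/33]+[10/33]+[13/33]-[5/33]-[11/33]-[14/33]`,
  `Γ(7/33)Γ(10/33)Γ(13/33)/(Γ(5/33)Γ(11/33)Γ(14/33)) = 3^{-1/4} 11^{1/12} (Π_dn sin / Π_up sin)^{1/2}`;
* `N = 35` (the canonical representative of Kubert's class `k₃₅`, Das 2000 §8):
  `f = [3/35]+[8/35]+[9/35]+[14/35]-[5/35]-[6/35]-[11/35]-[12/35]`.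

The non-membership proofs are parity functionals (`x ↦ x(1/3) + x(2/3)` at levels 15 and 33,
`x ↦ x(3/35)+x(17/35)+x(18/35)+x(32/35)` at level 35) that are even on every generator and odd on `f`;
the membership proofs are explicit integer certificates (7, 14, 13 generators). Everything is `decide`.
Role in the programme (paper/main.md §7 (c1)–(c5)): inside the formal period ring `P` the identity
`Γ(f) = α` is `u² = v²` with `u ≠ -v`, i.e. an instance of cancellation (`P` a domain), with no
transcendence content; at level 15 it is an instance of `Rung₂` (decided granted Huber–Wüstholz), at
level 33 of `Rung₃` (chain exists in principle since 08/2026), at level 35 of `Rung₄` (open).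
-/

namespace Summit.KontsevichZagierPeriods.KontsevichZagierPeriods.Theorems

section defs
variable (N : ℕ)

/-- The reflection vector `e_a + e_{-a}` on `ℤ/N` (shape of `hodge_eq_combination_den_two`). -/
def soloInformedReflVec (a : ZMod N) : ZMod N → ℤ :=
  fun x => (if a = x then 1 else 0) + (if -a = x then 1 else 0)

/-- The distribution vector `1_{x ≡ y (M)} - e_{(N/M)·y}` on `ℤ/N`, `M ∣ N`
(shape of `hodge_eq_combination_den_two`; it encodes Gauss' multiplication formula of index `N/M`). -/
def soloInformedDistVec (M : ℕ) (y : ZMod N) : ZMod N → ℤ :=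
  fun x => (if x.val % M = y.val % M then 1 else 0) - (if ((N / M : ℕ) : ZMod N) * y = x then 1 else 0)

/-- The standard generators at level `N`: all reflection vectors and all distribution vectors. -/
def soloInformedStdGen : Set (ZMod N → ℤ) :=
  {v | ∃ a : ZMod N, v = soloInformedReflVec N a} ∪
    {v | ∃ M ∈ N.divisors, ∃ y : ZMod N, v = soloInformedDistVec N M y}

/-- The lattice `L_N` of standard relations among `log Γ(x/N)` (modulo `log π`, `log` of algebraic numbers). -/
def soloInformedStdLattice : Submodule ℤ (ZMod N → ℤ) :=
  Submodule.span ℤ (soloInformedStdGen N)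

/-- Every reflection vector lies in `L_N`. -/
theorem soloInformed_reflVec_mem (a : ZMod N) :
    soloInformedReflVec N a ∈ soloInformedStdLattice N :=
  Submodule.subset_span (Or.inl ⟨a, rfl⟩)

/-- Every distribution vector of index dividing `N` lies in `L_N`. -/
theorem soloInformed_distVec_mem {M : ℕ} (hM : M ∈ N.divisors) (y : ZMod N) :
    soloInformedDistVec N M y ∈ soloInformedStdLattice N :=
  Submodule.subset_span (Or.inr ⟨M, hM, y, rfl⟩)

/-- Parity transfer: a `ℤ`-linear functional that is even on every standard generator is even on `L_N`. -/
theorem soloInformed_stdLattice_parity (φ : (ZMod N → ℤ) →ₗ[ℤ] ℤ)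
    (hgen : ∀ v ∈ soloInformedStdGen N, φ v % 2 = 0) :
    ∀ v ∈ soloInformedStdLattice N, φ v % 2 = 0 := by
  intro v hv
  induction hv using Submodule.span_induction with
  | mem v h => exact hgen v h
  | zero => simp
  | add u w _ _ hu hw => rw [map_add, Int.add_emod, hu, hw]; decide
  | smul c u _ hu => rw [map_smul, smul_eq_mul, Int.mul_emod, hu, mul_zero]; decide

/-- Generator tags: `inl a` = the reflection vector at `a`; `inr (M, y)` = the distribution vector. -/
def soloInformedGenVec : ZMod N ⊕ (ℕ × ZMod N) → (ZMod N → ℤ)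
  | .inl a => soloInformedReflVec N a
  | .inr (M, y) => soloInformedDistVec N M y

/-- A tag is admissible when its distribution index divides the level. -/
def soloInformedTagOK : ZMod N ⊕ (ℕ × ZMod N) → Bool
  | .inl _ => true
  | .inr (M, _) => decide (M ∈ N.divisors)

/-- An admissible tagged generator lies in `L_N`. -/
theorem soloInformed_genVec_mem : ∀ (t : ZMod N ⊕ (ℕ × ZMod N)), soloInformedTagOK N t = true →
    soloInformedGenVec N t ∈ soloInformedStdLattice N
  | .inl a, _ => soloInformed_reflVec_mem N a
  | .inr (M, y), ht => soloInformed_distVec_mem N (by simpa [soloInformedTagOK] using ht) y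

/-- An integer certificate: a signed list of admissible generators, evaluated pointwise. -/
def soloInformedCombo (L : List (ℤ × (ZMod N ⊕ (ℕ × ZMod N)))) : ZMod N → ℤ :=
  fun x => (L.map fun p => p.1 * soloInformedGenVec N p.2 x).sum

/-- The evaluation of a certificate with admissible tags lies in `L_N`. -/
theorem soloInformed_combo_mem : ∀ (L : List (ℤ × (ZMod N ⊕ (ℕ × ZMod N)))),
    (∀ p ∈ L, soloInformedTagOK N p.2 = true) → soloInformedCombo N L ∈ soloInformedStdLattice N
  | [], _ => by
      have h0 : soloInformedCombo N [] = 0 := by funext x; simp [soloInformedCombo]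
      rw [h0]; exact Submodule.zero_mem _
  | p :: L, h => by
      have hp : soloInformedTagOK N p.2 = true := h p (by simp)
      have hL := soloInformed_combo_mem L (fun q hq => h q (by simp [hq]))
      have hc : soloInformedCombo N (p :: L) = p.1 • soloInformedGenVec N p.2 + soloInformedCombo N L := by
        funext x; simp [soloInformedCombo]
      rw [hc]
      exact Submodule.add_mem _ (Submodule.smul_mem _ _ (soloInformed_genVec_mem N p.2 hp)) hL

end defs

/-! ## Level 15 — Das' example -/

/-- Das' exponent vector `[1/3] + [2/15] - [4/15] - [1/5]` at level `15`. -/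
def soloInformedDas15 : ZMod 15 → ℤ :=
  fun x => (if x = 5 ∨ x = 2 then 1 else 0) - (if x = 4 ∨ x = 3 then 1 else 0)

/-- The parity functional `x ↦ x(1/3) + x(2/3)` at level `15`. -/
def soloInformedParity15 : (ZMod 15 → ℤ) →ₗ[ℤ] ℤ where
  toFun v := v 5 + v 10
  map_add' u w := by simp only [Pi.add_apply]; ring
  map_smul' c u := by simp only [Pi.smul_apply, smul_eq_mul, RingHom.id_apply]; ring

/-- Pointwise formula for the level-15 parity functional. -/
theorem soloInformedParity15_apply (v : ZMod 15 → ℤ) : soloInformedParity15 v = v 5 + v 10 := rfl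

/-- The level-15 parity functional is even on every standard generator. -/
theorem soloInformedParity15_gen : ∀ v ∈ soloInformedStdGen 15, soloInformedParity15 v % 2 = 0 := by
  rintro v (⟨a, rfl⟩ | ⟨M, hM, y, rfl⟩) <;> rw [soloInformedParity15_apply]
  · revert a; decide
  · revert y; revert hM; revert M; decide

/-- **Das' identity is not standard**: `[1/3]+[2/15]-[4/15]-[1/5] ∉ L₁₅`. -/
theorem soloInformed_das15_not_mem : soloInformedDas15 ∉ soloInformedStdLattice 15 := by
  intro h
  have h2 := soloInformed_stdLattice_parity 15 soloInformedParity15 soloInformedParity15_gen _ h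
  rw [soloInformedParity15_apply] at h2
  revert h2; decide

/-- The integer certificate for `2·soloInformedDas15` (7 signed generators). -/
def soloInformedDas15Cert : List (ℤ × (ZMod 15 ⊕ (ℕ × ZMod 15))) :=
  [ (-1, .inr (3, 1)),
    (1, .inr (5, 1)),
    (1, .inr (5, 2)),
    (1, .inl 2),
    (-1, .inl 3),
    (-1, .inl 4),
    (1, .inl 5) ]

/-- … but its square is: `2·([1/3]+[2/15]-[4/15]-[1/5]) ∈ L₁₅` (explicit 7-term certificate). -/
theorem soloInformed_two_das15_mem : (2 : ℤ) • soloInformedDas15 ∈ soloInformedStdLattice 15 := by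
  have h : (2 : ℤ) • soloInformedDas15 = soloInformedCombo 15 soloInformedDas15Cert := by
    funext x
    simp only [Pi.smul_apply, smul_eq_mul]
    revert x; decide
  rw [h]
  exact soloInformed_combo_mem 15 _ (by decide)

/-! ## Level 33 — da Silva's Hodge class on the Fermat fourfold of degree 33 -/

/-- The exponent vector `[7/33]+[10/33]+[13/33]-[5/33]-[11/33]-[14/33]` (reflection-normalised form of
the Hodge character `(7,10,13,19,22,28)` of `X⁴₃₃`). -/
def soloInformedDaSilva33 : ZMod 33 → ℤ :=
  fun x => (if x = 7 ∨ x = 10 ∨ x = 13 then 1 else 0) - (if x = 5 ∨ x = 11 ∨ x = 14 then 1 else 0)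

/-- The parity functional `x ↦ x(1/3) + x(2/3)` at level `33`. -/
def soloInformedParity33 : (ZMod 33 → ℤ) →ₗ[ℤ] ℤ where
  toFun v := v 11 + v 22
  map_add' u w := by simp only [Pi.add_apply]; ring
  map_smul' c u := by simp only [Pi.smul_apply, smul_eq_mul, RingHom.id_apply]; ring

/-- Pointwise formula for the level-33 parity functional. -/
theorem soloInformedParity33_apply (v : ZMod 33 → ℤ) : soloInformedParity33 v = v 11 + v 22 := rfl

/-- The level-33 parity functional is even on every standard generator. -/
theorem soloInformedParity33_gen : ∀ v ∈ soloInformedStdGen 33, soloInformedParity33 v % 2 = 0 := by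
  rintro v (⟨a, rfl⟩ | ⟨M, hM, y, rfl⟩) <;> rw [soloInformedParity33_apply]
  · revert a; decide
  · revert y; revert hM; revert M; decide

/-- **The level-33 identity is not standard**: `Γ(7/33)Γ(10/33)Γ(13/33)/(Γ(5/33)Γ(11/33)Γ(14/33)) ∈ ℚ̄`
is not a consequence of reflection and multiplication (its exponent vector is not in `L₃₃`). -/
theorem soloInformed_daSilva33_not_mem : soloInformedDaSilva33 ∉ soloInformedStdLattice 33 := by
  intro h
  have h2 := soloInformed_stdLattice_parity 33 soloInformedParity33 soloInformedParity33_gen _ h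
  rw [soloInformedParity33_apply] at h2
  revert h2; decide

/-- The integer certificate for `2·soloInformedDaSilva33` (14 signed generators). -/
def soloInformedDaSilva33Cert : List (ℤ × (ZMod 33 ⊕ (ℕ × ZMod 33))) :=
  [ (1, .inr (3, 1)),
    (-1, .inr (11, 1)),
    (1, .inr (11, 2)),
    (-1, .inr (11, 3)),
    (-1, .inr (11, 4)),
    (-1, .inr (11, 5)),
    (-1, .inl 2),
    (-1, .inl 5),
    (1, .inl 6),
    (1, .inl 7),
    (-1, .inl 9),
    (1, .inl 10),
    (-1, .inl 11),
    (-1, .inl 14) ]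

/-- … but its square is (explicit 14-term certificate). -/
theorem soloInformed_two_daSilva33_mem :
    (2 : ℤ) • soloInformedDaSilva33 ∈ soloInformedStdLattice 33 := by
  have h : (2 : ℤ) • soloInformedDaSilva33 = soloInformedCombo 33 soloInformedDaSilva33Cert := by
    funext x
    simp only [Pi.smul_apply, smul_eq_mul]
    revert x; decide
  rw [h]
  exact soloInformed_combo_mem 33 _ (by decide)

/-! ## Level 35 — the canonical representative of Kubert's class `k₃₅` -/

/-- The exponent vector `[3/35]+[8/35]+[9/35]+[14/35]-[5/35]-[6/35]-[11/35]-[12/35]`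
(Das' canonical lifting of `k₃₅`; a Hodge `(3,3)`-character of the Fermat sixfold `X⁶₃₅`). -/
def soloInformedKubert35 : ZMod 35 → ℤ :=
  fun x => (if x = 3 ∨ x = 8 ∨ x = 9 ∨ x = 14 then 1 else 0)
    - (if x = 5 ∨ x = 6 ∨ x = 11 ∨ x = 12 then 1 else 0)

/-- The parity functional `x ↦ x(3/35) + x(17/35) + x(18/35) + x(32/35)` at level `35`. -/
def soloInformedParity35 : (ZMod 35 → ℤ) →ₗ[ℤ] ℤ where
  toFun v := v 3 + v 17 + v 18 + v 32
  map_add' u w := by simp only [Pi.add_apply]; ring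
  map_smul' c u := by simp only [Pi.smul_apply, smul_eq_mul, RingHom.id_apply]; ring

/-- Pointwise formula for the level-35 parity functional. -/
theorem soloInformedParity35_apply (v : ZMod 35 → ℤ) :
    soloInformedParity35 v = v 3 + v 17 + v 18 + v 32 := rfl

/-- The level-35 parity functional is even on every standard generator. -/
theorem soloInformedParity35_gen : ∀ v ∈ soloInformedStdGen 35, soloInformedParity35 v % 2 = 0 := by
  rintro v (⟨a, rfl⟩ | ⟨M, hM, y, rfl⟩) <;> rw [soloInformedParity35_apply]
  · revert a; decide
  · revert y; revert hM; revert M; decide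

/-- **The level-35 identity is not standard**:
`Γ(3/35)Γ(8/35)Γ(9/35)Γ(14/35)/(Γ(5/35)Γ(6/35)Γ(11/35)Γ(12/35)) ∈ ℚ̄` is not a consequence of reflection and
multiplication (exponent vector not in `L₃₅`). -/
theorem soloInformed_kubert35_not_mem : soloInformedKubert35 ∉ soloInformedStdLattice 35 := by
  intro h
  have h2 := soloInformed_stdLattice_parity 35 soloInformedParity35 soloInformedParity35_gen _ h
  rw [soloInformedParity35_apply] at h2
  revert h2; decide

/-- The integer certificate for `2·soloInformedKubert35` (13 signed generators). -/
def soloInformedKubert35Cert : List (ℤ × (ZMod 35 ⊕ (ℕ × ZMod 35))) :=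
  [ (-1, .inr (5, 1)),
    (-1, .inr (5, 2)),
    (1, .inr (7, 1)),
    (1, .inr (7, 2)),
    (1, .inr (7, 3)),
    (1, .inl 3),
    (-1, .inl 5),
    (-1, .inl 6),
    (1, .inl 8),
    (1, .inl 9),
    (-1, .inl 11),
    (-1, .inl 12),
    (1, .inl 14) ]

/-- … but its square is (explicit 13-term certificate). -/
theorem soloInformed_two_kubert35_mem :
    (2 : ℤ) • soloInformedKubert35 ∈ soloInformedStdLattice 35 := by
  have h : (2 : ℤ) • soloInformedKubert35 = soloInformedCombo 35 soloInformedKubert35Cert := by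
    funext x
    simp only [Pi.smul_apply, smul_eq_mul]
    revert x; decide
  rw [h]
  exact soloInformed_combo_mem 35 _ (by decide)

/-- Summary: at each of the levels `15, 33, 35` the exhibited Hodge-type exponent vector is a
`2`-torsion element of `ℤ^{ℤ/N}/L_N` that is not zero — a non-trivial Kubert class. -/
theorem soloInformed_kubertWitnesses :
    (soloInformedDas15 ∉ soloInformedStdLattice 15 ∧ (2 : ℤ) • soloInformedDas15 ∈ soloInformedStdLattice 15) ∧
    (soloInformedDaSilva33 ∉ soloInformedStdLattice 33 ∧
      (2 : ℤ) • soloInformedDaSilva33 ∈ soloInformedStdLattice 33) ∧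
    (soloInformedKubert35 ∉ soloInformedStdLattice 35 ∧
      (2 : ℤ) • soloInformedKubert35 ∈ soloInformedStdLattice 35) :=
  ⟨⟨soloInformed_das15_not_mem, soloInformed_two_das15_mem⟩,
   ⟨soloInformed_daSilva33_not_mem, soloInformed_two_daSilva33_mem⟩,
   ⟨soloInformed_kubert35_not_mem, soloInformed_two_kubert35_mem⟩⟩

end Summit.KontsevichZagierPeriods.KontsevichZagierPeriods.Theorems
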